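import Summits.AtomisticToContinuum.Crystallization.Theses.PhononSlackCertificates
import Summits.AtomisticToContinuum.Crystallization.Theorems.ChargedEnergyGap.Negative.Unconditional

/-!
# `CoerciveTwoShellGap` (stmt-AtomisticToContinuum-13956), negative side II: shape — free skeleton, separation, tightness

(refuter, cdisprove seat, cycle 1; no definition is introduced — statements are spelled out.)
Write `Gap(δ, g)` for the matrix of the crux,
`∀ N x, x δ-separated → N·e* + g·#{i : ¬ IsTwoShellGood (1/20) (47/50) 1 x i} ≤ 𝓔_LJ(x)`,
`e* = ⨅_Q e_LJ(Q)`; the crux is `∀ δ > 0, ∃ g > 0, Gap(δ, g)`.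
* the `g = 0` skeleton `N·e* ≤ 𝓔(x)` is FREE (`skeleton`: periodisation + `BddBelow`, both in the
  tree), so the whole content of the crux is `0 < g`;
* `e* ≤ −1/24` unconditionally (`iInf_le_neg_one_div`, periodised dimer);
* SEPARATION/INJECTIVITY IS LOAD-BEARING through Lean's junk value `V_LJ(0) = 0`: with the
  separation hypothesis dropped the statement fails for every `g > 0`
  (`coerciveTwoShellGap_false_without_sep`, the pile-up `k×0, k×e₀` of energy `−k²/12`),
  equivalently `0 < δ` cannot become `0 ≤ δ` (`coerciveTwoShellGap_false_at_delta_zero`);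
* TIGHTNESS: every admissible price has `g ≤ −e*` (one particle) and, at `δ ≤ 1`,
  `g ≤ −1/24 − e*` (dimer) (`g_le_neg_iInf_of_gap`, `g_le_of_gap`) — certified tightness stops here
  for want of a lower bound on `e*` in the tree (numerically `g_opt ≈ 2e-3`, a rattler);
* REFUTATION SHAPE: a violator is a near-minimiser, `0 ≤ 𝓔(x) − N·e* < g·#bad ≤ g·N`
  (`violation_squeeze`, `not_coerciveTwoShellGap_iff`) — certifying one needs `e*` from below to
  precision `g·#bad/N`.
All `[folklore]`.
-/

noncomputable section

namespace Summit.AtomisticToContinuum.Crystallization.Theorems.CoerciveTwoShellGapNegative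

open scoped BigOperators Classical
open Literature.MathematicalPhysics.StatisticalMechanics Literature.Geometry.DiscreteGeometry
open Summit.AtomisticToContinuum.Crystallization.Theorems.ChargedEnergyGapNegative
open Summit.AtomisticToContinuum.Crystallization.Theses.PhononSlackCertificates

/-! ## §1 The skeleton is free -/

/-- `δ`-separated configurations (`δ > 0`) are injective. [folklore] -/
theorem injective_of_sep {δ : ℝ} (hδ : 0 < δ) {N : ℕ} {x : Fin N → E3}
    (h : ∀ i j : Fin N, i ≠ j → δ ≤ dist (x i) (x j)) : Function.Injective x := by
  intro i j hij
  by_contra hne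
  have := h i j hne
  rw [hij, dist_self] at this
  linarith

/-- **The `g = 0` skeleton of the crux is free**: `N·e* ≤ 𝓔(x)` for every `δ`-separated `x`,
`δ > 0` (tree: periodisation with a large cubic period + `BddBelow` of the periodic energies).  All
content of the crux is `0 < g`. [folklore] -/
theorem skeleton {δ : ℝ} (hδ : 0 < δ) {N : ℕ} {x : Fin N → E3}
    (hx : ∀ i j : Fin N, i ≠ j → δ ≤ dist (x i) (x j)) :
    (N : ℝ) * (⨅ Q : PeriodicConfiguration 3, Q.energyPerParticle lennardJones) ≤
      interactionEnergy lennardJones x :=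
  card_mul_eStar_le (injective_of_sep hδ hx)

/-- **`e* ≤ −1/24 < 0`** unconditionally: the periodised dimer has energy per particle
`≤ E(dimer)/2 = −1/24` (cross-cell terms are `≤ 0`). [folklore] -/
theorem iInf_le_neg_one_div :
    (⨅ Q : PeriodicConfiguration 3, Q.energyPerParticle lennardJones) ≤ -1 / 24 := by
  have h1 := eStar_le (periodise dimer (periodUnit dimer) le_rfl (by norm_num : 0 < 2))
  have h2 := energyPerParticle_periodise_le dimer_injective (periodUnit dimer) le_rfl
    (by norm_num : 0 < 2)
  rw [interactionEnergy_dimer] at h2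
  have := h1.trans h2
  change eStar ≤ -1 / 24
  norm_num at this
  linarith

/-- With at most `18` particles nobody is `1/20`-good (the `18` pattern points are assigned
injectively to particles other than the centre). [folklore] -/
private theorem not_good_of_le {N : ℕ} (hN : N ≤ 18) (x : Fin N → E3) (i : Fin N) :
    ¬ IsTwoShellGood (1 / 20) (47 / 50) 1 x i := by
  rintro ⟨a, -, -, A, P, f, hP, hf, hinj, -⟩
  have hcard : P.card = 18 := card_eq_eighteen_of_twoShellPattern hP
  have himg : P.image f ⊆ Finset.univ.erase i := by
    intro j hj
    obtain ⟨v, hv, rfl⟩ := Finset.mem_image.1 hj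
    exact Finset.mem_erase.2 ⟨(hf v hv).1, Finset.mem_univ _⟩
  have h1 : (P.image f).card = 18 := by rw [Finset.card_image_of_injOn hinj, hcard]
  have h2 : (Finset.univ.erase i).card = N - 1 := by
    rw [Finset.card_erase_of_mem (Finset.mem_univ i), Finset.card_univ, Fintype.card_fin]
  have := Finset.card_le_card himg
  omega

/-- Hence configurations of at most `18` particles are all-bad. [folklore] -/
private theorem card_bad_of_le {N : ℕ} (hN : N ≤ 18) (x : Fin N → E3) :
    Nat.card {i : Fin N // ¬ IsTwoShellGood (1 / 20) (47 / 50) 1 x i} = N := by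
  rw [Nat.card_congr (Equiv.subtypeUnivEquiv (not_good_of_le hN x)), Nat.card_eq_fintype_card,
    Fintype.card_fin]

/-! ## §2 Load-bearing: separation / injectivity (a junk-model effect, `V_LJ(0) = 0`) -/

/-- **Without the separation hypothesis the crux is false for every `g > 0`**: the pile-up of `k`
particles at `0` and `k` at `e₀` has `𝓔 = −k²/12` (coincident pairs contribute `V_LJ(0) = 0`),
quadratic in `N = 2k`, against a left side `≥ 2k·e*`.  So any proof uses the separation
hypothesis — but only through injectivity (the `δ`-free injective form implies the crux with the
same `g`, and conversely by the landed `stub_sepReduction`). [folklore] -/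
theorem coerciveTwoShellGap_false_without_sep :
    ¬ ∃ g : ℝ, 0 < g ∧ ∀ (N : ℕ) (x : Fin N → E3),
      (N : ℝ) * (⨅ Q : PeriodicConfiguration 3, Q.energyPerParticle lennardJones) +
          g * (Nat.card {i : Fin N // ¬ IsTwoShellGood (1 / 20) (47 / 50) 1 x i} : ℝ) ≤
        interactionEnergy lennardJones x := by
  rintro ⟨g, hg, h⟩
  obtain ⟨k₀, hk₀⟩ := exists_nat_gt (24 * |eStar|)
  set k := k₀ + 1 with hk
  have hk' : 24 * |eStar| < k := by
    have : (k₀ : ℝ) ≤ k := by simp [hk]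
    linarith
  have hgk := h (k + k) (pile k)
  rw [interactionEnergy_pile] at hgk
  change ((k + k : ℕ) : ℝ) * eStar + _ ≤ _ at hgk
  push_cast at hgk
  have hb0 : (0 : ℝ) ≤
      (Nat.card {i : Fin (k + k) // ¬ IsTwoShellGood (1 / 20) (47 / 50) 1 (pile k) i} : ℝ) :=
    Nat.cast_nonneg _
  have h3 : -(|eStar| * (k + k)) ≤ ((k : ℝ) + k) * eStar := by
    have := neg_abs_le (((k : ℝ) + k) * eStar)
    rw [abs_mul, abs_of_nonneg (by positivity : (0 : ℝ) ≤ k + k)] at this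
    linarith
  have hkpos : (0 : ℝ) < k := by positivity
  have h4 : (k : ℝ) ^ 2 / 12 ≤ (k + k) * |eStar| := by nlinarith
  have h5 : (k : ℝ) ≤ 24 * |eStar| := by
    by_contra hlt
    push Not at hlt
    have h6 : (k : ℝ) * (24 * |eStar|) < (k : ℝ) * k := mul_lt_mul_of_pos_left hlt hkpos
    rw [pow_two] at h4
    linarith
  linarith

/-- **Equivalently, `0 < δ` cannot be weakened to `0 ≤ δ`**: at `δ = 0` the separation hypothesis
is vacuous and the pile-up applies. [folklore] -/
theorem coerciveTwoShellGap_false_at_delta_zero :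
    ¬ ∀ δ : ℝ, 0 ≤ δ → ∃ g : ℝ, 0 < g ∧ ∀ (N : ℕ) (x : Fin N → E3),
      (∀ i j : Fin N, i ≠ j → δ ≤ dist (x i) (x j)) →
        (N : ℝ) * (⨅ Q : PeriodicConfiguration 3, Q.energyPerParticle lennardJones) +
            g * (Nat.card {i : Fin N // ¬ IsTwoShellGood (1 / 20) (47 / 50) 1 x i} : ℝ) ≤
          interactionEnergy lennardJones x := by
  intro h
  obtain ⟨g, hg, hG⟩ := h 0 le_rfl
  exact coerciveTwoShellGap_false_without_sep ⟨g, hg, fun N x => hG N x fun i j _ => dist_nonneg⟩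

/-! ## §3 Tightness of the price `g` (certified part) -/

/-- **`g ≤ −e*`** for every admissible `(δ, g)`: one particle is bad and has energy `0`. [folklore] -/
theorem g_le_neg_iInf_of_gap {δ g : ℝ}
    (h : ∀ (N : ℕ) (x : Fin N → E3), (∀ i j : Fin N, i ≠ j → δ ≤ dist (x i) (x j)) →
      (N : ℝ) * (⨅ Q : PeriodicConfiguration 3, Q.energyPerParticle lennardJones) +
          g * (Nat.card {i : Fin N // ¬ IsTwoShellGood (1 / 20) (47 / 50) 1 x i} : ℝ) ≤
        interactionEnergy lennardJones x) :
    g ≤ -(⨅ Q : PeriodicConfiguration 3, Q.energyPerParticle lennardJones) := by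
  have h1 := h 1 (fun _ => 0) (fun i j hij => absurd (Subsingleton.elim i j) hij)
  rw [card_bad_of_le (N := 1) (by norm_num) (fun _ => 0), interactionEnergy_of_subsingleton] at h1
  push_cast at h1
  linarith

/-- **`g ≤ −1/24 − e*`** for every admissible `(δ, g)` with `δ ≤ 1`: the dimer at distance `1` is
`1`-separated, all-bad (`N = 2 ≤ 18`) and has energy `−1/12`.  Numerically (`e* ≈ −0.7175`) this is
`g ≲ 0.676`, whereas the uncertified optimum is `g_opt ≈ 2e-3` (one rattling atom flips `19`
statuses at relaxed cost `≈ 0.035`); closing the factor needs `e*` from below. [folklore] -/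
theorem g_le_of_gap {δ g : ℝ} (hδ : δ ≤ 1)
    (h : ∀ (N : ℕ) (x : Fin N → E3), (∀ i j : Fin N, i ≠ j → δ ≤ dist (x i) (x j)) →
      (N : ℝ) * (⨅ Q : PeriodicConfiguration 3, Q.energyPerParticle lennardJones) +
          g * (Nat.card {i : Fin N // ¬ IsTwoShellGood (1 / 20) (47 / 50) 1 x i} : ℝ) ≤
        interactionEnergy lennardJones x) :
    g ≤ -1 / 24 - (⨅ Q : PeriodicConfiguration 3, Q.energyPerParticle lennardJones) := by
  have hsep : ∀ i j : Fin 2, i ≠ j → δ ≤ dist (dimer i) (dimer j) := by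
    intro i j hij
    fin_cases i <;> fin_cases j <;> simp_all [dimer, dist_eq_norm]
  have h2 := h 2 dimer hsep
  rw [interactionEnergy_dimer, card_bad_of_le (N := 2) (by norm_num) dimer] at h2
  push_cast at h2
  linarith

/-- Consequently, if the crux holds, `e* < −1/24` (take `δ = 1` and the offered `g > 0`).
[folklore] -/
theorem iInf_lt_of_coerciveTwoShellGap (h : CoerciveTwoShellGap) :
    (⨅ Q : PeriodicConfiguration 3, Q.energyPerParticle lennardJones) < -1 / 24 := by
  obtain ⟨g, hg, hG⟩ := h 1 one_pos
  have := g_le_of_gap le_rfl hG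
  linarith

/-! ## §4 What a refutation must certify -/

/-- **A counterexample is a near-minimiser with dense badness**: if an injective `x` violates the
price `g`, then `0 ≤ 𝓔(x) − N·e* < g·#bad(x) ≤ g·N`.  Certifying such an `x` in Lean requires `e*`
FROM BELOW to precision `g·#bad/N`, i.e. a Kepler-type lower bound on all periodic Lennard-Jones
energies; the tree has none beyond stability constants. [folklore] -/
theorem violation_squeeze {g : ℝ} {N : ℕ} {x : Fin N → E3} (hx : Function.Injective x)
    (hlt : interactionEnergy lennardJones x <
      (N : ℝ) * (⨅ Q : PeriodicConfiguration 3, Q.energyPerParticle lennardJones) +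
        g * (Nat.card {i : Fin N // ¬ IsTwoShellGood (1 / 20) (47 / 50) 1 x i} : ℝ)) :
    0 ≤ interactionEnergy lennardJones x -
        (N : ℝ) * (⨅ Q : PeriodicConfiguration 3, Q.energyPerParticle lennardJones) ∧
      interactionEnergy lennardJones x -
          (N : ℝ) * (⨅ Q : PeriodicConfiguration 3, Q.energyPerParticle lennardJones) <
        g * (Nat.card {i : Fin N // ¬ IsTwoShellGood (1 / 20) (47 / 50) 1 x i} : ℝ) ∧
      (Nat.card {i : Fin N // ¬ IsTwoShellGood (1 / 20) (47 / 50) 1 x i} : ℝ) ≤ N := by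
  have h0 : (N : ℝ) * (⨅ Q : PeriodicConfiguration 3, Q.energyPerParticle lennardJones) ≤
      interactionEnergy lennardJones x := card_mul_eStar_le hx
  exact ⟨by linarith, by linarith,
    by exact_mod_cast (Finite.card_subtype_le _).trans_eq (Nat.card_fin N)⟩

/-- **Refutation shape**: `¬ crux` iff some `δ > 0` admits, for EVERY `g > 0`, a `δ`-separated
violator (whose excess is then squeezed as above). [folklore] -/
theorem not_coerciveTwoShellGap_iff :
    ¬ CoerciveTwoShellGap ↔ ∃ δ : ℝ, 0 < δ ∧ ∀ g : ℝ, 0 < g → ∃ (N : ℕ) (x : Fin N → E3),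
      (∀ i j : Fin N, i ≠ j → δ ≤ dist (x i) (x j)) ∧
        interactionEnergy lennardJones x <
          (N : ℝ) * (⨅ Q : PeriodicConfiguration 3, Q.energyPerParticle lennardJones) +
            g * (Nat.card {i : Fin N // ¬ IsTwoShellGood (1 / 20) (47 / 50) 1 x i} : ℝ) := by
  unfold CoerciveTwoShellGap
  push Not
  exact Iff.rfl

end Summit.AtomisticToContinuum.Crystallization.Theorems.CoerciveTwoShellGapNegative

end
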